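import Literature.AlgebraicGeometry.Resolution.ResolutionProjectiveReduction
import Literature.AlgebraicGeometry.Resolution.Macaulayfication
import Literature.AlgebraicGeometry.Resolution.KawasakiBlowupCM
import Literature.AlgebraicGeometry.Resolution.AlterationsResolution
import HarnessLib

/-!
# Macaulayfication: reduction to integral closed subschemes of projective spaces

Topic: `Literature/AlgebraicGeometry/Resolution`. Kawasaki's proof of his Macaulayfication
theorem (Kawasaki 2000, Thm. 1.1) ends with two formal reductions: "By using Chow's Lemma we
obtain a birational proper morphism `X' → X` such that `X'` is quasi-projective … the composition
`Y → X' → X` is a Macaulayfication of `X`" (proof of Thm. 1.1, p. 2539) and "since a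
quasi-projective scheme is an open dense subscheme of a projective scheme, we may consider only
projective schemes" (proof of Thm. 5.1, p. 2538). This file proves them in the vocabulary of
`KawasakiMacaulayfication` (`Macaulayfication.lean`), following the identical reduction for
resolutions (`ResolutionProjectiveReduction.lean`):

* `Scheme.HasMacaulayfication X` — a proper birational morphism `Y → X` from an integral scheme
  all of whose local rings satisfy the Cohen–Macaulay clause;
* `Scheme.HasMacaulayfication.of_iso`, `.restrict`, `.of_isOpenImmersion`, `.of_isBirational` —
  the transfer kit;
* `kawasakiMacaulayfication_of_projective` — if every integral closed subscheme of every `ℙⁿ_k`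
  has a Macaulayfication, then `KawasakiMacaulayfication` holds (Chow's lemma
  `ChowLemmaIntegral_holds` + projective closure `exists_projectiveClosure`).

Everything is proved; no named facts.

## References

* [Kawasaki2000] T. Kawasaki, *On Macaulayfication of Noetherian schemes*, Trans. AMS 352 (2000),
  proof of Thm. 1.1 (p. 2539) and of Thm. 5.1 (p. 2538).
* [GortzWedhorn2020] U. Görtz, T. Wedhorn, *Algebraic Geometry I*, 2nd ed., Thm. 13.100.
-/

noncomputable section

open CategoryTheory AlgebraicGeometry TopologicalSpace RingTheory.Sequence

namespace Literature.AlgebraicGeometry.Resolution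

universe u

/-- **`X` has a Macaulayfication**: there is a proper birational morphism `π : Y → X` from an
integral scheme `Y` all of whose local rings are Cohen–Macaulay in the sense of the inline clause
of `KawasakiMacaulayfication` (every system of parameters is a weakly regular sequence).
[cite: Kawasaki2000, Def. 1.0 / Thm. 1.1] -/
def Scheme.HasMacaulayfication (X : Scheme.{u}) : Prop :=
  ∃ (Y : Scheme.{u}) (π : Y ⟶ X), IsProper π ∧ IsBirational π ∧ IsIntegral Y ∧
    ∀ y : Y, ∀ d : ℕ, ringKrullDim (Y.presheaf.stalk y) = d →
      ∀ s : Fin d → Y.presheaf.stalk y, (Ideal.span (Set.range s)).radical.IsMaximal →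
        IsWeaklyRegular (Y.presheaf.stalk y) (List.ofFn s)

namespace Scheme.HasMacaulayfication

variable {X X' Z : Scheme.{u}}

/-- Macaulayfications transport along isomorphisms of the target. [folklore] -/
theorem of_iso (g : X ⟶ Z) [IsIso g] (h : Scheme.HasMacaulayfication X) :
    Scheme.HasMacaulayfication Z := by
  obtain ⟨Y, π, hprop, hbir, hint, hcm⟩ := h
  haveI := hprop
  exact ⟨Y, π ≫ g, inferInstance, hbir.comp_iso g, hint, hcm⟩

/-- **Proper birational morphisms transport Macaulayfications** (Kawasaki 2000, proof of
Thm. 1.1: "The composition `Y → X' → X` is a Macaulayfication of `X`").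
[cite: Kawasaki2000, Thm. 1.1 (proof)] -/
theorem of_isBirational (ρ : X' ⟶ X) [IsProper ρ] (hρ : IsBirational ρ)
    (h : Scheme.HasMacaulayfication X') : Scheme.HasMacaulayfication X := by
  obtain ⟨Y, π, hprop, hbir, hint, hcm⟩ := h
  haveI := hprop
  exact ⟨Y, π ≫ ρ, inferInstance, hbir.comp hρ, hint, hcm⟩

/-- A birational universally closed morphism is surjective (dominant with closed image).
[folklore] -/
theorem _root_.Literature.AlgebraicGeometry.Resolution.IsBirational.surjective_of_universallyClosed
    {Y : Scheme.{u}} {π : Y ⟶ X} (h : IsBirational π) [UniversallyClosed π] :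
    Function.Surjective π := by
  have hd : DenseRange π := h.isDominant.denseRange
  have hc : IsClosed (Set.range π) := π.isClosedMap.isClosed_range
  rw [← Set.range_eq_univ, ← hc.closure_eq, hd.closure_range]

/-- **Macaulayfications restrict to non-empty open subschemes** (Kawasaki 2000, proof of
Thm. 5.1: "we may consider only projective schemes"): `π⁻¹(U) → U` is proper and birational,
`π⁻¹(U)` is a non-empty open of the integral `Y`, and its local rings are local rings of `Y`.
[cite: Kawasaki2000, Thm. 5.1 (proof, first reduction)] -/
theorem restrict (h : Scheme.HasMacaulayfication X) (U : X.Opens) [Nonempty U] :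
    Scheme.HasMacaulayfication (U : Scheme.{u}) := by
  obtain ⟨Y, π, hprop, hbir, hint, hcm⟩ := h
  haveI := hprop
  haveI := hint
  -- `π⁻¹(U)` is non-empty: `π` is surjective
  obtain ⟨⟨u, hu⟩⟩ := ‹Nonempty U›
  obtain ⟨y, hy⟩ := hbir.surjective_of_universallyClosed u
  haveI : Nonempty (π ⁻¹ᵁ U : Y.Opens) := ⟨⟨y, show π y ∈ U by rw [hy]; exact hu⟩⟩
  haveI : IsIntegral (π ⁻¹ᵁ U : Scheme.{u}) := isIntegral_of_isOpenImmersion (π ⁻¹ᵁ U).ι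
  refine ⟨_, π ∣_ U, inferInstance, hbir.morphismRestrict U, inferInstance, fun x => ?_⟩
  exact cmClause_of_ringEquiv' (asIso ((π ⁻¹ᵁ U).ι.stalkMap x)).commRingCatIsoToRingEquiv
    (hcm _)

/-- Macaulayfications transport along open immersions with non-empty source. [folklore] -/
theorem of_isOpenImmersion {U : Scheme.{u}} [Nonempty U] (j : U ⟶ X) [IsOpenImmersion j]
    (h : Scheme.HasMacaulayfication X) : Scheme.HasMacaulayfication U := by
  haveI : Nonempty j.opensRange := by
    obtain ⟨u⟩ := ‹Nonempty U›
    exact ⟨⟨j u, ⟨u, rfl⟩⟩⟩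
  exact Scheme.HasMacaulayfication.of_iso (Scheme.Hom.isoOpensRange j).inv (h.restrict j.opensRange)

end Scheme.HasMacaulayfication

/-- **Kawasaki's Macaulayfication reduces to integral closed subschemes of projective spaces**
(Kawasaki 2000, proof of Thm. 1.1 and first paragraph of the proof of Thm. 5.1): if every integral
scheme admitting a closed immersion into some `ℙⁿ_k` has a Macaulayfication, then so does every
integral separated `k`-scheme of finite type — by Chow's lemma (`ChowLemmaIntegral_holds`) there
is a proper birational integral `X' → X` immersed in `ℙⁿ_k`, whose projective closure `X̄'`
(`exists_projectiveClosure`) has a Macaulayfication, which restricts to `X'` and composes with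
`X' → X`. [cite: Kawasaki2000, Thm. 1.1 (proof), Thm. 5.1 (proof)] -/
theorem kawasakiMacaulayfication_of_projective
    (h : ∀ (k : Type u) [Field k] (n : ℕ) (X : Scheme.{u})
      (ι : X ⟶ (Motives.projectiveSpace n k).left),
      IsClosedImmersion ι → IsIntegral X → Scheme.HasMacaulayfication X) :
    KawasakiMacaulayfication.{u} := by
  intro k _ X f hsep hft hqc hint
  obtain ⟨n, X', π, ι, hint', hι, hπ, -, -, U, hU, hU', hiso⟩ :=
    ChowLemmaIntegral_holds k X f hsep hft hqc hint
  haveI := hπ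
  haveI := hι
  haveI := hint'
  have hbir : IsBirational π := ⟨U, hU, hU', hiso⟩
  obtain ⟨Xbar, j, c, hXbar, hj, hc, -, -⟩ := exists_projectiveClosure ι
  haveI := hj
  haveI : Nonempty X' := inferInstance
  have hmac : Scheme.HasMacaulayfication X :=
    Scheme.HasMacaulayfication.of_isBirational π hbir
      ((h k n Xbar c hc hXbar).of_isOpenImmersion j)
  obtain ⟨Y, ρ, hρ, hρb, hY, hcm⟩ := hmac
  exact ⟨Y, ρ, hρ, hρb, hY, hcm⟩

end Literature.AlgebraicGeometry.Resolution

end
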